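import Mathlib
import Summits.Ventures.HodgeRepro2.HeckeSlashNormalizer
import Summits.Ventures.HodgeRepro2.HeckeFiniteIndex
import Summits.Ventures.HodgeRepro2.MultiplicityOnePeriod

/-!
# AtkinLehnerEigenvalues — an involutive Hecke operator on the Petersson space has eigenvalues `±1`

Blind cell `pub-hodge-repro2`, seat p2 (Tier 5 kernel support, Hecke side).

For `δ ∈ U(H)(K)` normalising `S` with `δ² = 1`, `HeckeSlashNormalizer.lean` gives
`T_δ (T_δ f) = f` on the ball. On the Petersson space (classes of forms agreeing on the ball):

* **`heckeFamilyOf_heckeFamilyOf_eq_self_of_normalizes_of_sq_eq_one`**: `T_δ ∘ T_δ = id`;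
* **`heckeFamilyOf_eigenvalue_eq_one_or_neg_one_of_normalizes_of_sq_eq_one`**: every eigenvalue
  of `T_δ` is `1` or `-1` — the Atkin–Lehner sign.
-/

namespace Summit.Ventures.HodgeRepro2.ShimuraData

open MeasureTheory

variable {K : Type*} [Field K] [NumberField K] [NumberField.IsCMField K] {τ₁ : K →+* ℂ}
  {H : Matrix (Fin 3) (Fin 3) K} {Q : Matrix (Fin 3) (Fin 3) ℂ} (hQ : IsFrame K τ₁ H Q)
  (S : Subgroup (GL (Fin 3) K)) (hS : (S : Set (GL (Fin 3) K)) ⊆ unitaryGroup K H)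
  [CompactSpace (ballQuotient hQ S hS)] {D : Set ball₂} (k : ℕ)
  (hD : IsBallFundamentalDomain hQ S hS D) (hDm : MeasurableSet D)
  (inst : ∀ δ : unitaryGroup K H, Fintype (S ⧸ (heckeSubgroup S (δ : GL (Fin 3) K)).subgroupOf S))

/-- **`T_δ ∘ T_δ = id` on the Petersson space** for `δ` normalising `S` with `δ² = 1`. -/
theorem heckeFamilyOf_heckeFamilyOf_eq_self_of_normalizes_of_sq_eq_one {δ : unitaryGroup K H}
    (hδ : ∀ s, s ∈ S ↔ (δ : GL (Fin 3) K) * s * (δ : GL (Fin 3) K)⁻¹ ∈ S)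
    (hδδ : (δ : GL (Fin 3) K) * δ = 1) (v : PeterssonSpace hQ S hS k hD) :
    heckeFamilyOf hQ S hS k hD hDm inst δ (heckeFamilyOf hQ S hS k hD hDm inst δ v) = v := by
  obtain ⟨f, rfl⟩ := SeparationQuotient.surjective_mk v
  letI := inst δ
  letI := inst δ⁻¹
  change (SeparationQuotient.mk (heckeForms hQ S hS k hD δ.2 (heckeForms hQ S hS k hD δ.2 f)) :
    PeterssonSpace hQ S hS k hD) = SeparationQuotient.mk f
  rw [PeterssonSpace.mk_eq_mk_iff]
  intro z hz
  rw [heckeForms_apply_coe, heckeForms_apply_coe]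
  exact hecke_hecke_eq_self_of_normalizes_of_sq_eq_one hQ hS hδ δ.2 hδδ
    ((mem_weightForms τ₁ Q S k).mp (PeterssonForms.toForm hQ S hS k hD f).2).1 hz

/-- **Atkin–Lehner signs**: an eigenvalue of an involutive Hecke operator is `1` or `-1`. -/
theorem heckeFamilyOf_eigenvalue_eq_one_or_neg_one_of_normalizes_of_sq_eq_one
    {δ : unitaryGroup K H}
    (hδ : ∀ s, s ∈ S ↔ (δ : GL (Fin 3) K) * s * (δ : GL (Fin 3) K)⁻¹ ∈ S)
    (hδδ : (δ : GL (Fin 3) K) * δ = 1) {v : PeterssonSpace hQ S hS k hD} (hv : v ≠ 0) {μ : ℂ}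
    (hμ : heckeFamilyOf hQ S hS k hD hDm inst δ v = μ • v) : μ = 1 ∨ μ = -1 := by
  have h1 := heckeFamilyOf_heckeFamilyOf_eq_self_of_normalizes_of_sq_eq_one hQ S hS k hD hDm inst
    hδ hδδ v
  rw [hμ, map_smul, hμ, smul_smul] at h1
  -- `(μ * μ) • v = v` with `v ≠ 0`
  have h2 : (μ * μ - 1) • v = 0 := by rw [sub_smul, one_smul, h1, sub_self]
  rcases smul_eq_zero.mp h2 with h3 | h3
  · exact mul_self_eq_one_iff.mp (sub_eq_zero.mp h3)
  · exact absurd h3 hv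

end Summit.Ventures.HodgeRepro2.ShimuraData
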